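import Literature.Combinatorics.Additive.BalogSzemerediGowersMultiplicative
import Mathlib.Algebra.GroupWithZero.Pointwise.Finset

/-!
# Crux `DlogGraphFlat` (stmt-QuantumAdvantage-10732), line `Sketch` — sector A: popular
# differences of a set with small product set (`stub_dlogPopularDiff`, S1 ⟹ S2)

A zero-free `A ⊆ 𝔽_p` with `|A|² ≤ 2p`, `|AA| ≤ K|A|` has `r_{A−A}(d) ≤ C K^c |A|^{1−κ₀}`
(`d ≠ 0`), given the weak sum–product theorem S1 (hypothesis). Route (`card_le_chain`):
`E₊(AA) ≥ |A|·r(d)²` (`card_mul_sq_le_addEnergy_mul`); additive BSG (`Zhao2023_thm7136_holds`,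
proved in tree) gives `X' ⊆ AA` with small `X' + X'`; `|X'X'| ≤ |AAAA| ≤ K⁴|A|` by Plünnecke–Ruzsa
in `𝔽_pˣ` (`card_mul_mul_mul_le`); S1 on `X'`, or on a subset of size `⌊√(p−1)⌋`
(`card_le_of_sumProduct`), bounds `|X'|`; bookkeeping `chain_bound`, `repr_le_of_chain`.
-/

set_option linter.dupNamespace false -- D-0017: single-problem summit ⇒ `QuantumAdvantage.QuantumAdvantage` by design

namespace Summit.QuantumAdvantage.QuantumAdvantage.Theorems.SymplecticPurity

open Finset Literature.Combinatorics.Additive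
open scoped Pointwise Combinatorics.Additive

/-- Energy lower bound from one popular difference: if `P ⊆ {(y, y') ∈ A × A : y − y' = d}`,
`d ≠ 0`, `A` zero-free, then `E₊(AA) ≥ |A|·|P|²` — the quadruples `(x y₁, x y₂, x y₂', x y₁')`
(`x ∈ A`, `(yᵢ, yᵢ') ∈ P`) are distinct additive quadruples of `AA`. -/
theorem card_mul_sq_le_addEnergy_mul {F : Type*} [Field F] [DecidableEq F] (A : Finset F)
    (hA0 : (0 : F) ∉ A) {d : F} (hd : d ≠ 0) (P : Finset (F × F))
    (hP : ∀ q ∈ P, q.1 ∈ A ∧ q.2 ∈ A ∧ q.1 - q.2 = d) :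
    #A * (#P * #P) ≤ E[A * A, A * A] := by
  rw [← card_product, ← card_product]
  unfold Finset.addEnergy
  refine card_le_card_of_injOn (fun q : F × (F × F) × (F × F) =>
    ((q.1 * q.2.1.1, q.1 * q.2.2.1), (q.1 * q.2.2.2, q.1 * q.2.1.2))) ?_ ?_
  · rintro ⟨x, ⟨y₁, z₁⟩, ⟨y₂, z₂⟩⟩ hq
    simp only [mem_coe, mem_product] at hq
    obtain ⟨hx, hq₁, hq₂⟩ := hq
    obtain ⟨hy₁, hz₁, h₁⟩ : y₁ ∈ A ∧ z₁ ∈ A ∧ y₁ - z₁ = d := hP _ hq₁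
    obtain ⟨hy₂, hz₂, h₂⟩ : y₂ ∈ A ∧ z₂ ∈ A ∧ y₂ - z₂ = d := hP _ hq₂
    simp only [mem_coe, mem_filter, mem_product]
    refine ⟨⟨⟨mul_mem_mul hx hy₁, mul_mem_mul hx hy₂⟩, mul_mem_mul hx hz₂, mul_mem_mul hx hz₁⟩, ?_⟩
    rw [sub_eq_iff_eq_add.mp h₁, sub_eq_iff_eq_add.mp h₂]
    ring
  · rintro ⟨x, ⟨y₁, z₁⟩, ⟨y₂, z₂⟩⟩ hq ⟨x', ⟨y₁', z₁'⟩, ⟨y₂', z₂'⟩⟩ hq' heq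
    simp only [mem_coe, mem_product] at hq hq'
    simp only [Prod.mk.injEq] at heq ⊢
    obtain ⟨⟨h11, h12⟩, h21, h22⟩ := heq
    have hd₁ : y₁ - z₁ = d := (hP _ hq.2.1).2.2
    have hd₁' : y₁' - z₁' = d := (hP _ hq'.2.1).2.2
    have hxx : x = x' := by
      refine mul_right_cancel₀ hd ?_
      calc x * d = x * y₁ - x * z₁ := by rw [← hd₁, mul_sub]
        _ = x' * y₁' - x' * z₁' := by rw [h11, h22]
        _ = x' * d := by rw [← hd₁', mul_sub]
    have hx0 : x ≠ 0 := fun h => hA0 (h ▸ hq.1)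
    rw [← hxx] at h11 h12 h21 h22
    exact ⟨hxx, ⟨mul_left_cancel₀ hx0 h11, mul_left_cancel₀ hx0 h22⟩,
      mul_left_cancel₀ hx0 h12, mul_left_cancel₀ hx0 h21⟩

/-- Plünnecke–Ruzsa in the group `𝔽ˣ` (through `Additive 𝔽ˣ`): for a zero-free `A`,
`|AA·AA| · |A|³ ≤ |AA|⁴`. -/
theorem card_mul_mul_mul_le {F : Type*} [Field F] [DecidableEq F] (A : Finset F)
    (hA0 : (0 : F) ∉ A) : #(A * A * (A * A)) * #A ^ 3 ≤ #(A * A) ^ 4 := by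
  rcases A.eq_empty_or_nonempty with rfl | hAne
  · simp
  set φ : Additive Fˣ → F := fun x => ((Additive.toMul x : Fˣ) : F) with hφ
  have hinj : Function.Injective φ := val_toMul_injective
  set Au := A.preimage φ hinj.injOn with hAu
  have himg : Au.image φ = A := image_val_preimage_units A hA0
  have hcard : #Au = #A := by rw [← himg, card_image_of_injective _ hinj]
  have hAune : Au.Nonempty := by rw [← card_pos, hcard, card_pos]; exact hAne
  have h2 : (Au + Au).image φ = A * A := by rw [image_val_add_eq_mul, himg]
  have h4 : (Au + Au + (Au + Au)).image φ = A * A * (A * A) := by rw [image_val_add_eq_mul, h2]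
  have hPR := Finset.pluennecke_ruzsa_inequality_nsmul_add hAune Au (2 + 2)
  rw [add_nsmul, two_nsmul] at hPR
  have hAu0 : (#Au : ℚ≥0) ≠ 0 := by exact_mod_cast hAune.card_pos.ne'
  have key : ((#(Au + Au + (Au + Au)) : ℕ) : ℚ≥0) * (#Au : ℚ≥0) ^ 3 ≤ (#(Au + Au) : ℚ≥0) ^ 4 := by
    calc ((#(Au + Au + (Au + Au)) : ℕ) : ℚ≥0) * (#Au : ℚ≥0) ^ 3
        ≤ ((#(Au + Au) : ℚ≥0) / #Au) ^ (2 + 2) * #Au * (#Au : ℚ≥0) ^ 3 := by gcongr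
      _ = ((#(Au + Au) : ℚ≥0) / #Au * #Au) ^ 4 := by ring
      _ = (#(Au + Au) : ℚ≥0) ^ 4 := by rw [div_mul_cancel₀ _ hAu0]
  rw [← h4, card_image_of_injective _ hinj, ← hcard, ← h2, card_image_of_injective _ hinj]
  exact_mod_cast key

/-- `r_{A−A}(d) ≤ |A|`: the first projection is injective on `{(y, y') ∈ A × A : y − y' = d}`. -/
theorem card_filter_sub_eq_le {F : Type*} [Field F] [DecidableEq F] (A : Finset F) (d : F) :
    #((A ×ˢ A).filter fun x : F × F => x.1 - x.2 = d) ≤ #A := by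
  refine card_le_card_of_injOn Prod.fst (fun x hx => ?_) fun x hx y hy h => ?_
  · simp only [mem_coe, mem_filter, mem_product] at hx
    exact mem_coe.2 hx.1.1
  · simp only [mem_coe, mem_filter] at hx hy
    have h2 : x.2 = x.1 - d := by rw [← hx.2]; ring
    have h2' : y.2 = y.1 - d := by rw [← hy.2]; ring
    exact Prod.ext h (by rw [h2, h2', h])

/-- The sum–product hypothesis `S1` (stated for `|Y|² < p`) bounds every zero-free `Y ⊆ 𝔽_p` with
`|Y + Y|, |YY| ≤ K₂|Y|`, `|Y| ≤ K n` and `n² ≤ 2p`: `|Y| ≤ 3K C₀ (3 K K₂)^{e₀}` (if `|Y|² ≥ p`,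
apply `S1` to a subset of size `s = ⌊√(p−1)⌋`, for which `n ≤ 3s`). -/
theorem card_le_of_sumProduct {p : ℕ} [hp : Fact p.Prime] {C₀ e₀ : ℝ} (hC₀ : 0 < C₀)
    (he₀ : 0 < e₀)
    (hSP : ∀ (A : Finset (ZMod p)) (K : ℝ), (0 : ZMod p) ∉ A → A.Nonempty → 1 ≤ K →
      (A.card : ℝ) ^ 2 < (p : ℝ) → ((A + A).card : ℝ) ≤ K * A.card →
      ((A * A).card : ℝ) ≤ K * A.card → (A.card : ℝ) ≤ C₀ * K ^ e₀)
    (Y : Finset (ZMod p)) (hY0 : (0 : ZMod p) ∉ Y) (hYne : Y.Nonempty) {K₂ K n : ℝ}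
    (hK₂ : 1 ≤ K₂) (hK : 1 ≤ K) (hn2p : n ^ 2 ≤ 2 * (p : ℝ))
    (hYKn : (#Y : ℝ) ≤ K * n) (hYa : (#(Y + Y) : ℝ) ≤ K₂ * #Y)
    (hYm : (#(Y * Y) : ℝ) ≤ K₂ * #Y) :
    (#Y : ℝ) ≤ 3 * K * C₀ * (3 * K * K₂) ^ e₀ := by
  have hK0 : 0 ≤ K := by linarith
  have hK₂0 : 0 ≤ K₂ := by linarith
  have h3K : 1 ≤ 3 * K := by linarith
  have hpow : K₂ ^ e₀ ≤ (3 * K * K₂) ^ e₀ :=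
    Real.rpow_le_rpow hK₂0 (le_mul_of_one_le_left hK₂0 h3K) he₀.le
  by_cases hsmall : (#Y : ℝ) ^ 2 < p
  · calc (#Y : ℝ) ≤ C₀ * K₂ ^ e₀ := hSP Y K₂ hY0 hYne hK₂ hsmall hYa hYm
      _ ≤ C₀ * (3 * K * K₂) ^ e₀ := mul_le_mul_of_nonneg_left hpow hC₀.le
      _ ≤ 3 * K * (C₀ * (3 * K * K₂) ^ e₀) := le_mul_of_one_le_left (by positivity) h3K
      _ = 3 * K * C₀ * (3 * K * K₂) ^ e₀ := by ring
  -- the large case `p ≤ |Y|²`: pass to a subset `Y''` of size `s`, `s² < p ≤ (s + 1)²`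
  have hbig : p ≤ #Y ^ 2 := by exact_mod_cast (not_lt.1 hsmall : (p : ℝ) ≤ (#Y : ℝ) ^ 2)
  obtain ⟨s, hs2, hps⟩ : ∃ s : ℕ, s * s < p ∧ p ≤ (s + 1) * (s + 1) :=
    ⟨Nat.sqrt (p - 1), (Nat.sqrt_le (p - 1)).trans_lt (Nat.sub_lt hp.out.pos one_pos),
      by have := Nat.lt_succ_sqrt (p - 1); rw [Nat.succ_eq_add_one] at this; omega⟩
  have hs1 : 1 ≤ s := Nat.pos_of_ne_zero fun h => by
    rw [h] at hps; linarith [hp.out.two_le]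
  have hsY : s ≤ #Y := by
    by_contra h
    have h' : #Y * #Y < s * s := Nat.mul_self_lt_mul_self (not_le.1 h)
    exact lt_irrefl _ ((hbig.trans_eq (sq _)).trans_lt (h'.trans hs2))
  obtain ⟨Y'', hY''Y, hY''c⟩ := exists_subset_card_eq hsY
  have hY''0 : (0 : ZMod p) ∉ Y'' := fun h => hY0 (hY''Y h)
  have hY''ne : Y''.Nonempty := by rw [← card_pos, hY''c]; exact hs1
  have hs0 : (0 : ℝ) < s := by exact_mod_cast hs1
  have hsp : ((#Y'' : ℕ) : ℝ) ^ 2 < p := by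
    rw [hY''c]; exact_mod_cast (by rw [sq]; exact hs2 : s ^ 2 < p)
  have hLs : (s : ℝ) ≤ #Y := by exact_mod_cast hsY
  set K₃ : ℝ := K₂ * #Y / s with hK₃
  have hK₃s : K₃ * s = K₂ * #Y := div_mul_cancel₀ _ hs0.ne'
  have hK₃1 : 1 ≤ K₃ := by
    rw [hK₃, le_div_iff₀ hs0, one_mul]
    exact hLs.trans (le_mul_of_one_le_left (Nat.cast_nonneg _) hK₂)
  have hY''a : (#(Y'' + Y'') : ℝ) ≤ K₃ * #Y'' := by
    rw [hY''c, hK₃s]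
    calc (#(Y'' + Y'') : ℝ) ≤ #(Y + Y) := mod_cast card_le_card (add_subset_add hY''Y hY''Y)
      _ ≤ K₂ * #Y := hYa
  have hY''m : (#(Y'' * Y'') : ℝ) ≤ K₃ * #Y'' := by
    rw [hY''c, hK₃s]
    calc (#(Y'' * Y'') : ℝ) ≤ #(Y * Y) := mod_cast card_le_card (mul_subset_mul hY''Y hY''Y)
      _ ≤ K₂ * #Y := hYm
  have hsb := hSP Y'' K₃ hY''0 hY''ne hK₃1 hsp hY''a hY''m
  rw [hY''c] at hsb
  have hs1r : (1 : ℝ) ≤ s := by exact_mod_cast hs1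
  have hpsr : (p : ℝ) ≤ ((s : ℝ) + 1) * ((s : ℝ) + 1) := by exact_mod_cast hps
  have hp4 : (p : ℝ) ≤ 4 * (s : ℝ) ^ 2 := by nlinarith
  have hn3s : n ≤ 3 * s := by
    have h9 : n ^ 2 ≤ (3 * (s : ℝ)) ^ 2 := by nlinarith
    exact (abs_le_of_sq_le_sq' h9 (by positivity)).2
  have hLK : (#Y : ℝ) ≤ 3 * K * s :=
    hYKn.trans ((mul_le_mul_of_nonneg_left hn3s hK0).trans_eq (by ring))
  have hK₃0 : 0 ≤ K₃ := by positivity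
  have hK₃le : K₃ ≤ 3 * K * K₂ := by
    rw [hK₃, div_le_iff₀ hs0]
    calc K₂ * #Y ≤ K₂ * (3 * K * s) := mul_le_mul_of_nonneg_left hLK hK₂0
      _ = 3 * K * K₂ * s := by ring
  calc (#Y : ℝ) ≤ 3 * K * s := hLK
    _ ≤ 3 * K * (C₀ * K₃ ^ e₀) := mul_le_mul_of_nonneg_left hsb (by positivity)
    _ ≤ 3 * K * (C₀ * (3 * K * K₂) ^ e₀) :=
        mul_le_mul_of_nonneg_left
          (mul_le_mul_of_nonneg_left (Real.rpow_le_rpow hK₃0 hK₃le he₀.le) hC₀.le) (by positivity)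
    _ = 3 * K * C₀ * (3 * K * K₂) ^ e₀ := by ring

/-- Real bookkeeping: `n ≤ m ≤ Q₁ L`, `Q₁ = C₁ K'^{C₁}`, `K' ≤ K³ (n/R)²` and
`L ≤ 3K C₀ (3K · K⁴Q₁)^{e₀}` give `n ≤ M Kᵃ (n/R)^{2b}` with `b = C₁(1 + e₀)`,
`a = 1 + 5e₀ + 3b`, `M = 3^{1+e₀} C₀ C₁^{1+e₀}`. -/
theorem chain_bound {C₀ e₀ C₁ K K' n R m L : ℝ} (hC₀ : 1 ≤ C₀) (he₀ : 0 < e₀) (hC₁ : 1 ≤ C₁)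
    (hK : 1 ≤ K) (hn : 0 < n) (hR : 0 < R) (hK'1 : 1 ≤ K') (hK' : K' ≤ K ^ 3 * (n / R) ^ 2)
    (hnm : n ≤ m) (hmL : m ≤ C₁ * K' ^ C₁ * L)
    (hL : L ≤ 3 * K * C₀ * (3 * K * (K ^ 4 * (C₁ * K' ^ C₁))) ^ e₀) :
    n ≤ 3 ^ (1 + e₀) * C₀ * C₁ ^ (1 + e₀) * K ^ (1 + 5 * e₀ + 3 * (C₁ * (1 + e₀))) *
      (n / R) ^ (2 * (C₁ * (1 + e₀))) := by
  have hK0 : 0 < K := by linarith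
  have hK'0 : 0 < K' := by linarith
  have hC₁0 : 0 < C₁ := by linarith
  have hC₀0 : 0 < C₀ := by linarith
  have hnR : 0 < n / R := by positivity
  have hQ0 : 0 < C₁ * K' ^ C₁ := by positivity
  have h30 : (0 : ℝ) < 3 := by norm_num
  set b := C₁ * (1 + e₀) with hb
  have hb0 : 0 ≤ b := by positivity
  have hexp : (3 * K * (K ^ 4 * (C₁ * K' ^ C₁))) ^ e₀ =
      3 ^ e₀ * K ^ (5 * e₀) * C₁ ^ e₀ * K' ^ (C₁ * e₀) := by
    have e1 : 3 * K * (K ^ 4 * (C₁ * K' ^ C₁)) = 3 * K ^ ((5 : ℕ) : ℝ) * (C₁ * K' ^ C₁) := by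
      rw [Real.rpow_natCast]; ring
    have h3K5 : (0 : ℝ) ≤ 3 * K ^ ((5 : ℕ) : ℝ) := by positivity
    have hK5 : (0 : ℝ) ≤ K ^ ((5 : ℕ) : ℝ) := by positivity
    have hKC : (0 : ℝ) ≤ K' ^ C₁ := by positivity
    rw [e1, Real.mul_rpow h3K5 hQ0.le, Real.mul_rpow h30.le hK5, Real.mul_rpow hC₁0.le hKC,
      ← Real.rpow_mul hK0.le, ← Real.rpow_mul hK'0.le]
    push_cast
    ring
  have hK'b : K' ^ b ≤ K ^ (3 * b) * (n / R) ^ (2 * b) := by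
    calc K' ^ b ≤ (K ^ 3 * (n / R) ^ 2) ^ b := Real.rpow_le_rpow hK'0.le hK' hb0
      _ = (K ^ 3) ^ b * ((n / R) ^ 2) ^ b := Real.mul_rpow (by positivity) (by positivity)
      _ = K ^ (3 * b) * (n / R) ^ (2 * b) := by
          rw [← Real.rpow_natCast K 3, ← Real.rpow_natCast (n / R) 2, ← Real.rpow_mul hK0.le,
            ← Real.rpow_mul hnR.le]
          push_cast
          ring_nf
  have hM0 : 0 ≤ 3 ^ (1 + e₀) * C₀ * C₁ ^ (1 + e₀) * K ^ (1 + 5 * e₀) := by positivity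
  calc n ≤ m := hnm
    _ ≤ C₁ * K' ^ C₁ * L := hmL
    _ ≤ C₁ * K' ^ C₁ * (3 * K * C₀ * (3 * K * (K ^ 4 * (C₁ * K' ^ C₁))) ^ e₀) :=
        mul_le_mul_of_nonneg_left hL hQ0.le
    _ = 3 ^ (1 + e₀) * C₀ * C₁ ^ (1 + e₀) * K ^ (1 + 5 * e₀) * K' ^ b := by
        rw [hexp, Real.rpow_add h30, Real.rpow_add hC₁0, Real.rpow_add hK0, hb, mul_add C₁ 1 e₀,
          mul_one, Real.rpow_add hK'0]
        simp only [Real.rpow_one]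
        ring
    _ ≤ 3 ^ (1 + e₀) * C₀ * C₁ ^ (1 + e₀) * K ^ (1 + 5 * e₀) * (K ^ (3 * b) * (n / R) ^ (2 * b)) :=
        mul_le_mul_of_nonneg_left hK'b hM0
    _ = 3 ^ (1 + e₀) * C₀ * C₁ ^ (1 + e₀) * K ^ (1 + 5 * e₀ + 3 * b) * (n / R) ^ (2 * b) := by
        rw [Real.rpow_add hK0 (1 + 5 * e₀) (3 * b)]
        ring

/-- Real bookkeeping: `n ≤ M Kᵃ (n/R)^{2b}` with `M ≥ 1`, `2b ≥ 1` gives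
`R ≤ M K^{a/(2b)} n^{1 − 1/(2b)}`. -/
theorem repr_le_of_chain {M K a b n R : ℝ} (hM : 1 ≤ M) (hK : 1 ≤ K) (hb : 0 < b)
    (hb1 : 1 ≤ 2 * b) (hn : 0 < n) (hR : 0 < R) (h : n ≤ M * K ^ a * (n / R) ^ (2 * b)) :
    R ≤ M * K ^ (a / (2 * b)) * n ^ (1 - 1 / (2 * b)) := by
  set t : ℝ := 1 / (2 * b) with ht
  have ht0 : 0 < t := by positivity
  have ht1 : t ≤ 1 := by rw [ht, div_le_one (by positivity)]; exact hb1
  have hbt : 2 * b * t = 1 := by rw [ht, mul_one_div_cancel (by positivity)]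
  have hM0 : 0 ≤ M := by linarith
  have hK0 : 0 ≤ K := by linarith
  have hnR : 0 ≤ n / R := by positivity
  have hKa : 0 ≤ K ^ a := Real.rpow_nonneg hK0 a
  have hnRb : 0 ≤ (n / R) ^ (2 * b) := Real.rpow_nonneg hnR _
  have h1 : n ^ t ≤ M ^ t * K ^ (a * t) * (n / R) := by
    calc n ^ t ≤ (M * K ^ a * (n / R) ^ (2 * b)) ^ t := Real.rpow_le_rpow hn.le h ht0.le
      _ = M ^ t * (K ^ a) ^ t * ((n / R) ^ (2 * b)) ^ t := by
          rw [Real.mul_rpow (mul_nonneg hM0 hKa) hnRb, Real.mul_rpow hM0 hKa]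
      _ = M ^ t * K ^ (a * t) * (n / R) := by
          rw [← Real.rpow_mul hK0, ← Real.rpow_mul hnR, hbt, Real.rpow_one]
  have h2 : R * n ^ t ≤ M ^ t * K ^ (a * t) * n := by
    calc R * n ^ t ≤ R * (M ^ t * K ^ (a * t) * (n / R)) := mul_le_mul_of_nonneg_left h1 hR.le
      _ = M ^ t * K ^ (a * t) * n := by field_simp
  have hnt : 0 < n ^ t := Real.rpow_pos_of_pos hn t
  calc R ≤ M ^ t * K ^ (a * t) * n / n ^ t := by rw [le_div_iff₀ hnt]; exact h2
    _ = M ^ t * K ^ (a * t) * n ^ (1 - t) := by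
        rw [Real.rpow_sub hn, Real.rpow_one, mul_div_assoc]
    _ ≤ M * K ^ (a * t) * n ^ (1 - t) :=
        mul_le_mul_of_nonneg_right (mul_le_mul_of_nonneg_right
          (Real.rpow_le_self_of_one_le hM ht1) (Real.rpow_nonneg hK0 _)) (Real.rpow_nonneg hn.le _)
    _ = M * K ^ (a / (2 * b)) * n ^ (1 - t) := by rw [ht, mul_one_div]

/-- The combinatorial chain of S2 for one zero-free `A ⊆ 𝔽_p` and one `d ≠ 0` with `r(d) ≥ 1`:
energy bound, BSG (hypothesis `hBSG`, constant `C₁ ≤ C₁'`), Plünnecke–Ruzsa and the sum–product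
hypothesis `hSP` (`C₀ ≤ C₀'`, `e₀`) give `|A| ≤ 3^{1+e₀} C₀' C₁'^{1+e₀} K^{1+5e₀+3b} (|A|/r)^{2b}`,
`r = r(d)`, `b = C₁'(1 + e₀)`. -/
theorem card_le_chain {p : ℕ} [Fact p.Prime] {C₀ e₀ C₁ C₀' C₁' : ℝ} (hC₀ : 0 < C₀) (he₀ : 0 < e₀)
    (hSP : ∀ (A : Finset (ZMod p)) (K : ℝ), (0 : ZMod p) ∉ A → A.Nonempty → 1 ≤ K →
      (A.card : ℝ) ^ 2 < (p : ℝ) → ((A + A).card : ℝ) ≤ K * A.card →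
      ((A * A).card : ℝ) ≤ K * A.card → (A.card : ℝ) ≤ C₀ * K ^ e₀)
    (hBSG : ∀ (X : Finset (ZMod p)) (L : ℝ), X.Nonempty → 1 ≤ L →
      (X.card : ℝ) ^ 3 / L ≤ E[X, X] →
      ∃ X' ⊆ X, (X.card : ℝ) ≤ C₁ * L ^ C₁ * X'.card ∧ ((X' + X').card : ℝ) ≤ C₁ * L ^ C₁ * X'.card)
    (hC₀C : C₀ ≤ C₀') (hC₀'1 : 1 ≤ C₀') (hC₁C : C₁ ≤ C₁') (hC₁'1 : 1 ≤ C₁')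
    (A : Finset (ZMod p))
    {K : ℝ} (hA0 : (0 : ZMod p) ∉ A) (hK : 1 ≤ K) (hA2p : (#A : ℝ) ^ 2 ≤ 2 * (p : ℝ))
    (hAA : (#(A * A) : ℝ) ≤ K * #A) {d : ZMod p} (hd : d ≠ 0) (P : Finset (ZMod p × ZMod p))
    (hP : P = (A ×ˢ A).filter fun x : ZMod p × ZMod p => x.1 - x.2 = d) (hPpos : 0 < #P) :
    (#A : ℝ) ≤ 3 ^ (1 + e₀) * C₀' * C₁' ^ (1 + e₀) * K ^ (1 + 5 * e₀ + 3 * (C₁' * (1 + e₀))) *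
      ((#A : ℝ) / #P) ^ (2 * (C₁' * (1 + e₀))) := by
  have hPmem : ∀ q ∈ P, q.1 ∈ A ∧ q.2 ∈ A ∧ q.1 - q.2 = d := fun q hq => by
    simpa only [hP, mem_filter, mem_product, and_assoc] using hq
  have hPA : #P ≤ #A := hP ▸ card_filter_sub_eq_le A d
  have hApos : 0 < #A := hPpos.trans_le hPA
  have hAne : A.Nonempty := card_pos.1 hApos
  obtain ⟨X, hX⟩ : ∃ X : Finset (ZMod p), X = A * A := ⟨_, rfl⟩
  have hX0 : (0 : ZMod p) ∉ X := hX ▸ fun h => by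
    obtain ⟨x, hx, y, hy, hxy⟩ := mem_mul.1 h
    rcases mul_eq_zero.1 hxy with h0 | h0; exacts [hA0 (h0 ▸ hx), hA0 (h0 ▸ hy)]
  have hAX : #A ≤ #X := hX ▸ card_le_card_mul_self₀
  have hXne : X.Nonempty := card_pos.1 (hApos.trans_le hAX)
  have hE : #A * (#P * #P) ≤ E[X, X] := hX ▸ card_mul_sq_le_addEnergy_mul A hA0 hd P hPmem
  have hXX : #(X * X) * #A ^ 3 ≤ #X ^ 4 := hX ▸ card_mul_mul_mul_le A hA0
  have hmK : (#X : ℝ) ≤ K * #A := hX ▸ hAA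
  have hn0 : (0 : ℝ) < #A := by exact_mod_cast hApos
  have hR0 : (0 : ℝ) < #P := by exact_mod_cast hPpos
  have hRn : (#P : ℝ) ≤ #A := by exact_mod_cast hPA
  have hnm : (#A : ℝ) ≤ #X := by exact_mod_cast hAX
  have hm0 : (0 : ℝ) < #X := hn0.trans_le hnm
  have hden : (0 : ℝ) < #A * (#P : ℝ) ^ 2 := by positivity
  obtain ⟨K', hK'⟩ : ∃ K' : ℝ, K' = (#X : ℝ) ^ 3 / (#A * (#P : ℝ) ^ 2) := ⟨_, rfl⟩
  have hK'1 : 1 ≤ K' := by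
    rw [hK', le_div_iff₀ hden, one_mul]
    calc (#A : ℝ) * (#P : ℝ) ^ 2 ≤ #A * (#A : ℝ) ^ 2 := by gcongr
      _ = (#A : ℝ) ^ 3 := by ring
      _ ≤ (#X : ℝ) ^ 3 := by gcongr
  have hK'0 : 0 ≤ K' := by linarith
  have hEK : (#X : ℝ) ^ 3 / K' ≤ E[X, X] := by
    rw [hK', div_div_eq_mul_div, mul_div_cancel_left₀ _ (by positivity)]
    calc (#A : ℝ) * (#P : ℝ) ^ 2 = ((#A * (#P * #P) : ℕ) : ℝ) := by push_cast; ring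
      _ ≤ E[X, X] := by exact_mod_cast hE
  have hK'le : K' ≤ K ^ 3 * ((#A : ℝ) / #P) ^ 2 := by
    have hRne : (#P : ℝ) ≠ 0 := hR0.ne'
    rw [hK', div_le_iff₀ hden]
    calc (#X : ℝ) ^ 3 ≤ (K * #A) ^ 3 := pow_le_pow_left₀ hm0.le hmK 3
      _ = K ^ 3 * ((#A : ℝ) / #P) ^ 2 * (#A * (#P : ℝ) ^ 2) := by field_simp
  obtain ⟨X', hX'X, h1, h2⟩ := hBSG X K' hXne hK'1 hEK
  have hQQ₁ : C₁ * K' ^ C₁ ≤ C₁' * K' ^ C₁' :=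
    mul_le_mul hC₁C (Real.rpow_le_rpow_of_exponent_le hK'1 hC₁C) (Real.rpow_nonneg hK'0 _)
      (by linarith)
  have hQ₁1 : 1 ≤ C₁' * K' ^ C₁' :=
    one_le_mul_of_one_le_of_one_le hC₁'1 (Real.one_le_rpow hK'1 (by linarith))
  have hX'c0 : (0 : ℝ) ≤ #X' := Nat.cast_nonneg _
  have h1' : (#X : ℝ) ≤ C₁' * K' ^ C₁' * #X' := h1.trans (mul_le_mul_of_nonneg_right hQQ₁ hX'c0)
  have h2' : (#(X' + X') : ℝ) ≤ C₁' * K' ^ C₁' * #X' :=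
    h2.trans (mul_le_mul_of_nonneg_right hQQ₁ hX'c0)
  have hX'pos : (0 : ℝ) < #X' := by
    rcases eq_or_lt_of_le hX'c0 with h | h
    · rw [← h, mul_zero] at h1'; linarith
    · exact h
  have hX'ne : X'.Nonempty := by rw [← card_pos]; exact_mod_cast hX'pos
  have hX'0 : (0 : ZMod p) ∉ X' := fun h => hX0 (hX'X h)
  have hXXr : (#(X * X) : ℝ) ≤ K ^ 4 * #A := by
    have h' : (#(X * X) : ℝ) * (#A : ℝ) ^ 3 ≤ (#X : ℝ) ^ 4 := by exact_mod_cast hXX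
    refine le_of_mul_le_mul_right ?_ (by positivity : (0 : ℝ) < (#A : ℝ) ^ 3)
    calc (#(X * X) : ℝ) * (#A : ℝ) ^ 3 ≤ (#X : ℝ) ^ 4 := h'
      _ ≤ (K * #A) ^ 4 := pow_le_pow_left₀ hm0.le hmK 4
      _ = K ^ 4 * #A * (#A : ℝ) ^ 3 := by ring
  have hK41 : (1 : ℝ) ≤ K ^ 4 := one_le_pow₀ hK
  have hK₂1 : 1 ≤ K ^ 4 * (C₁' * K' ^ C₁') := one_le_mul_of_one_le_of_one_le hK41 hQ₁1
  have hX'm : (#(X' * X') : ℝ) ≤ K ^ 4 * (C₁' * K' ^ C₁') * #X' := by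
    calc (#(X' * X') : ℝ) ≤ #(X * X) := mod_cast card_le_card (mul_subset_mul hX'X hX'X)
      _ ≤ K ^ 4 * #A := hXXr
      _ ≤ K ^ 4 * #X := by gcongr
      _ ≤ K ^ 4 * (C₁' * K' ^ C₁' * #X') := by gcongr
      _ = K ^ 4 * (C₁' * K' ^ C₁') * #X' := by ring
  have hX'a : (#(X' + X') : ℝ) ≤ K ^ 4 * (C₁' * K' ^ C₁') * #X' :=
    h2'.trans (mul_le_mul_of_nonneg_right (le_mul_of_one_le_left (by linarith) hK41) hX'c0)
  have hX'X : #X' ≤ #X := card_le_card hX'X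
  have hX'Kn : (#X' : ℝ) ≤ K * #A := le_trans (by exact_mod_cast hX'X) hmK
  have hL := card_le_of_sumProduct hC₀ he₀ hSP X' hX'0 hX'ne hK₂1 hK hA2p hX'Kn hX'a hX'm
  have hL' : (#X' : ℝ) ≤ 3 * K * C₀' * (3 * K * (K ^ 4 * (C₁' * K' ^ C₁'))) ^ e₀ := by
    refine hL.trans ?_
    gcongr
  exact chain_bound hC₀'1 he₀ hC₁'1 hK hn0 hR0 hK'1 hK'le hnm h1' hL'

/-- **Stub S2 (sector A, popular differences of a set with small product set, from S1 + BSG +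
Plünnecke–Ruzsa).** The sum–product bound S1 implies: for a zero-free `A ⊆ 𝔽_p` with `|A|² ≤ 2p`
and `|A A| ≤ K|A|`, every non-zero difference `d` has `r_{A−A}(d) ≤ C K^c |A|^{1−κ₀}`
(absolute `κ₀ ∈ (0,1]`, `C, c > 0`); here `κ₀ = 1/(2b)`, `b = C₁'(1+e₀)`, `c = (1+5e₀+3b)/(2b)`,
`C = 3^{1+e₀} C₀' C₁'^{1+e₀}` with `C₀' = max C₀ 1` (S1) and `C₁' = max C₁ 1` (BSG, Zhao 7.13.6). -/
theorem stub_dlogPopularDiff :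
    (∃ C₀ : ℝ, 0 < C₀ ∧ ∃ e₀ : ℝ, 0 < e₀ ∧ ∀ (p : ℕ) [Fact (Nat.Prime p)] (A : Finset (ZMod p)) (K : ℝ),
      (0 : ZMod p) ∉ A → A.Nonempty → 1 ≤ K → (A.card : ℝ) ^ 2 < (p : ℝ) →
      ((A + A).card : ℝ) ≤ K * A.card → ((A * A).card : ℝ) ≤ K * A.card →
      (A.card : ℝ) ≤ C₀ * K ^ e₀) →
    ∃ κ₀ : ℝ, 0 < κ₀ ∧ κ₀ ≤ 1 ∧ ∃ C : ℝ, 0 < C ∧ ∃ c : ℝ, 0 < c ∧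
      ∀ (p : ℕ) [Fact (Nat.Prime p)] (A : Finset (ZMod p)) (K : ℝ),
      (0 : ZMod p) ∉ A → 1 ≤ K → (A.card : ℝ) ^ 2 ≤ 2 * (p : ℝ) →
      ((A * A).card : ℝ) ≤ K * A.card → ∀ d : ZMod p, d ≠ 0 →
      ((((A ×ˢ A).filter fun x : ZMod p × ZMod p => x.1 - x.2 = d).card : ℝ)) ≤
        C * K ^ c * (A.card : ℝ) ^ (1 - κ₀) := by
  rintro ⟨C₀, hC₀, e₀, he₀, hSP⟩
  obtain ⟨C₁, -, hBSG⟩ := Zhao2023_thm7136_holds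
  obtain ⟨C₀', hC₀C, hC₀'1⟩ : ∃ C : ℝ, C₀ ≤ C ∧ 1 ≤ C :=
    ⟨max C₀ 1, le_max_left _ _, le_max_right _ _⟩
  obtain ⟨C₁', hC₁C, hC₁'1⟩ : ∃ C : ℝ, C₁ ≤ C ∧ 1 ≤ C :=
    ⟨max C₁ 1, le_max_left _ _, le_max_right _ _⟩
  obtain ⟨b, hb⟩ : ∃ b : ℝ, b = C₁' * (1 + e₀) := ⟨_, rfl⟩
  have hb1 : 1 ≤ b := by rw [hb]; exact one_le_mul_of_one_le_of_one_le hC₁'1 (by linarith)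
  have hb0 : 0 < b := by linarith
  obtain ⟨a, ha⟩ : ∃ a : ℝ, a = 1 + 5 * e₀ + 3 * b := ⟨_, rfl⟩
  have ha0 : 0 < a := by rw [ha]; positivity
  obtain ⟨M, hM⟩ : ∃ M : ℝ, M = 3 ^ (1 + e₀) * C₀' * C₁' ^ (1 + e₀) := ⟨_, rfl⟩
  have hM1 : 1 ≤ M := hM ▸ one_le_mul_of_one_le_of_one_le (one_le_mul_of_one_le_of_one_le
    (Real.one_le_rpow (by norm_num) (by linarith)) hC₀'1) (Real.one_le_rpow hC₁'1 (by linarith))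
  refine ⟨1 / (2 * b), by positivity, ?_, M, by linarith, a / (2 * b), by positivity, ?_⟩
  · rw [div_le_one (by positivity)]; linarith
  intro p hp A K hA0 hK hA2p hAA d hd
  obtain ⟨P, hP⟩ : ∃ P : Finset (ZMod p × ZMod p),
      P = (A ×ˢ A).filter (fun x : ZMod p × ZMod p => x.1 - x.2 = d) := ⟨_, rfl⟩
  rw [← hP]
  rcases Nat.eq_zero_or_pos #P with hP0 | hPpos
  · rw [hP0, Nat.cast_zero]
    have hK0 : 0 ≤ K := by linarith
    have := Real.rpow_nonneg hK0 (a / (2 * b))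
    have := Real.rpow_nonneg (Nat.cast_nonneg (#A) : (0 : ℝ) ≤ #A) (1 - 1 / (2 * b))
    positivity
  have hR0 : (0 : ℝ) < #P := by exact_mod_cast hPpos
  have hn0 : (0 : ℝ) < #A := by exact_mod_cast hPpos.trans_le (hP ▸ card_filter_sub_eq_le A d)
  have hchain := card_le_chain hC₀ he₀ (hSP p) (hBSG (ZMod p)) hC₀C hC₀'1 hC₁C hC₁'1 A hA0 hK hA2p
    hAA hd P hP hPpos
  rw [← hM, ← hb, ← ha] at hchain
  exact repr_le_of_chain hM1 hK hb0 (by linarith) hn0 hR0 hchain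

end Summit.QuantumAdvantage.QuantumAdvantage.Theorems.SymplecticPurity
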